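import Summits.QuantumFields.YangMills.Theorems.BalabanUVNodesN16LeafSlotAllTorus
import Summits.QuantumFields.YangMills.Theorems.BalabanUVNodesN16HolderMSSlotWindow

/-!
# Route «BalabanUVNodes», cluster K4 «SpineRates» — node N16 = NE3: THE WINDOW RECIPES AND THE PER-FAMILY «PROVISO ∧ SLOT» LEMMAS FOR THE THREE LEAF SLOTS KEYED AT THE
# ALL-TORUS PROPER SUB-INDEX (`LeafSlotAT` ∕ `LeafSlotHolderAT β` ∕ `LeafSlotHolderMSAT β`, module 32) — twins of this seat's file 17 `…N16SlotWindowLinear` §3 (p484035),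
# file 18 `…N16HolderSlotWindow` §2–§3 (p485315) and module 26 `…N16HolderMSSlotWindow` §2–§3 (p499974) with node N05's `Thm4Body` ∕ `Prop3Body` read on the sub-family
# `{i : ZdIdx 4 F.L // (∀ j, i.Ω j = univ) ∧ (∀ m j, i.Λs m j = {y | j = m}) ∧ (∀ m j, i.Λb m j = {c | j = m}) ∧ i.η = ((F.L : ℝ)⁻¹) ^ i.k}` (PINNED spacing, dag-n16-c F47∕F48); STAGE-FREE (no record edition is read)

Cell `pub-ymgap`, seat `pub-ymgap-dag-n16-e` (R134 acceleration seat (a), strategy s2 = BY-NAME KNIT at the record; HUMAN RULING D-0062; chair R424 venue), generation 7,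
module 33 (THEOREMS ONLY, 0 `def`, 0 `sorry`, standard axioms).  `--kind proof --supports <K3 id of record> --as helper`.  `bears_on: R4∕N16 · edge N05 → N16 · edge N07 → N16 ·
out-edge N16 → N21`.  Over module 32 `…N16LeafSlotAllTorus` (the AT-keyed slots) and module 26 `…N16HolderMSSlotWindow` (through it files 13∕17∕18: the PUBLIC slot-free
arithmetic `slotLetterLines`, `leafLines_of_linear`, `slotHolderLineMS` and the proviso lemmas `inEndRegime(H∕HMS)_ofRecord_of_window`, all reused BY NAME).  Statements =
the landed statements with the N05 family's index subtype swapped and the slot renamed; proofs verbatim.  Restates nothing.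

WHY (LOCATED-4 of this seat; see module 32's header).  After dag-n16-c g6's p511253 the univ sub-family of n05-a's index contains members no printed supplier serves;
n05-a's sound currency is per proper member and n16-c's R-b″ tops read the all-torus proper sub-index.  These lemmas are the STAGE-FREE step «three content clauses at
windowed letters ⟹ proviso ∧ AT-slot at RR-1's object of record `ne3OfRecord₁₁ F (ne3ConstLayerOfRecord₁₁ F N (ℓ F))`» that every AT-keyed N16 LINE (module 34 in the
proviso-generic tuple currency; the Core-home editions after dag-n22-e's Core homes) composes with the home's constant-layer collapse.  The univ-keyed originals imply these (module 32 §2) but are VACUOUS as stated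
(dag-n16-c F49 refutes their `Prop3Body` conjunct at the empty-bond univ members); these are the live statements.

CONTENT.  §1 exponent `β` — `leafSlotHolderAT_ofRecord_of_window_lines` · `leafSlotHolderAT_ofRecord_of_window_linear` (at `β = 1` they conclude `LeafSlotAT`, `rfl`);
§2 multi-scale — `leafSlotHolderMSAT_ofRecord_of_window_lines` · `leafSlotHolderMSAT_ofRecord_of_window_linear` (length letter `len (j • e μ) = j`); §3 per family, the
proviso of each currency AND the AT-slot at RR-1's object `ne3OfRecord₁₁ F (ne3ConstLayerOfRecord₁₁ F N (ℓ F))`: `inEndRegime_and_leafSlotAT_ofRecord_of_window_linear`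
(thresholds `radiusOfRecord` ∕ `constOfRecord`) · `inEndRegimeH_and_leafSlotHolderAT_ofRecord_of_window_linear` (`radiusOfRecordH` ∕ `constOfRecordH`) ·
`inEndRegimeHMS_and_leafSlotHolderMSAT_ofRecord_of_window_linear` (`radiusOfRecordHMS` ∕ `constOfRecordHMS`).

HONEST FRAMING.  Kernel bookkeeping (packaging of displayed letter lines); no estimate; N05's `Thm4Body` ∕ `Prop3Body` ([Balaban1985RegularSpaces] Thm 4 ∕ Prop 3 TYPES, at
the all-torus proper members) and N07's `LeafH3sup` ([Balaban1985Variational] Thm 1 (8)+(10) TYPE) are HYPOTHESES asserted for no family; the letters are PARAMETERS on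
displayed lines (jointly satisfiable by files 13∕18∕26's `exists_window_letters_numerals(_H∕_HMS)`, unchanged); nothing of Bałaban's asserted; **N16 ∕ NE3 is NOT discharged**;
count-neutral (typed 28∕28 · discharged 5∕27, A 5∕28 UNMOVED); one finite four-torus at fixed ε — NOT ℝ⁴, NOT infinite volume, NOT OS, NOT a mass gap, NOT Clay.
-/

set_option autoImplicit false

open scoped BigOperators Matrix Matrix.Norms.L2Operator
open NormedSpace

namespace Summit.QuantumFields.YangMills.BalabanUVNodes.N16SlotWindowAllTorus

open Literature.MathematicalPhysics.QuantumFieldTheory.Balaban1983to89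
open Literature.MathematicalPhysics.QuantumFieldTheory.Balaban1983to89.T4Continuum (T4Family ULoop)
open B7Prop1Explicit B7Prop2Explicit
open B7Prop3Flat (c3)
open B8LeafModelZd (ZdIdx)
open B8LeafModelZd3 (zdGF3)
open Node00 (NE3Objects₁₁ NE3Letters₁₁ ne3ConstLayerOfRecord₁₁ ne3NperOfRecord₁₁ ne3DomOfRecord₁₁ one_le_ne3NperOfRecord₁₁)
open Summit.QuantumFields.BalabanUV.T4Continuum
open BlockAverageCurrent (curConst curConst_nonneg)
open NE3RightInverseSupLetters (frameC)
open NE3.LeafIndexSockets (LeafH3sup)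
open YMDAG.UVSplit (NE3Carriers ne3OfRecord₁₁)
open Summit.QuantumFields.YangMills.BalabanUVNodes.N16Regime (InEndRegime radiusOfRecord constOfRecord)
open Summit.QuantumFields.YangMills.BalabanUVNodes.N16HolderRegime (InEndRegimeH radiusOfRecordH constOfRecordH)
open Summit.QuantumFields.YangMills.BalabanUVNodes.N16HolderMSRegime (InEndRegimeHMS radiusOfRecordHMS constOfRecordHMS)
open Summit.QuantumFields.YangMills.BalabanUVNodes.N16SlotWindow (inEndRegime_ofRecord_of_window)
open Summit.QuantumFields.YangMills.BalabanUVNodes.N16SlotWindowLinear (slotLetterLines leafLines_of_linear)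
open Summit.QuantumFields.YangMills.BalabanUVNodes.N16HolderSlotWindow (inEndRegimeH_ofRecord_of_window)
open Summit.QuantumFields.YangMills.BalabanUVNodes.N16HolderMSSlotWindow (slotHolderLineMS inEndRegimeHMS_ofRecord_of_window)
open Summit.QuantumFields.YangMills.BalabanUVNodes.N16LeafSlotAllTorus (LeafSlotAT LeafSlotHolderAT LeafSlotHolderMSAT)

noncomputable section

variable {N : ℕ}

/-! ## §1 The window recipes at exponent `β` (dag-n16-c's R-β slot, AT-keyed; `β = 1` is the slot of record `LeafSlotAT`) -/

/-- **THE WINDOW RECIPE AT EXPONENT `β`, LINE-EXACT** — `LeafSlotHolderAT · β` AT RR-1's OBJECT FROM ITS THREE CONTENT CLAUSES (file 17's `leafSlotAT_ofRecord_of_window_lines`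
with N05's family at `zdGF3 (M_N ℂ) F.L β len`): N07's leaf letters enter only through the slot's four displayed `(b', c')`-lines; `o.ε < α` free; the eleven derived
numeric lines are file 17's `slotLetterLines`. [folklore] -/
theorem leafSlotHolderAT_ofRecord_of_window_lines (F : T4Family) (o : NE3Objects₁₁ N) {β : ℝ}
    {len : Site 4 → ℝ} (hlen : ∀ v : Site 4, 0 < len v → 1 ≤ len v) (hlen1 : ∀ μ : Fin 4, len (e μ) = 1)
    {c₁ c₁' B₁' cP C₂ B₀β : ℝ} {inp : B8.B9Inputs} (hB₁' : 0 < B₁') (hBB : 5 * ((4 : ℕ) : ℝ) * F.L * inp.B₀ ≤ B₁') (hc₁' : 0 < c₁')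
    (hwin : ∀ α₀ α₁ : ℝ, 0 < α₀ → 0 < α₁ → α₀ + α₁ ≤ c₁' →
      α₀ + α₁ ≤ c₁ ∧ C0 4 * (2 * α₀) ≤ 1 / 3 ∧ 4 * α₀ ≤ c2' 4 F.L ∧ 16 * (B₁' * (α₀ + α₁)) ≤ 1 ∧
      Real.exp (4 * (800 * (((4 : ℕ) : ℝ) + 1) ^ 2 * (((4 : ℕ) : ℝ) + 4)) * α₀) * (1 + 8 * (131072 * (((4 : ℕ) : ℝ) + 1) ^ 2) * (B₁' * (α₀ + α₁))) ≤ 2 ∧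
      2 * (B₁' * (α₀ + α₁)) ≤ c3 4 F.L ∧ ((4 : ℕ) : ℝ) * F.L * α₁ ≤ 1 / 8 ∧ α₀ ≤ cP ∧ α₁ ≤ cP ∧ B₁' * (α₀ + α₁) ≤ cP ∧
      2 * (B₁' * (α₀ + α₁)) ^ 2 + 20 * ((4 : ℕ) : ℝ) * α₀ * (B₁' * (α₀ + α₁)) + 2 * C₂ * (B₁' * (α₀ + α₁)) ^ 2 ≤ α₀ + α₁)
    {α : ℝ} (hα : 0 < α) (hα1 : α ≤ c₁' / 177) (hα2 : α ≤ o.Λ₁ / (1770 * (5 * ((4 : ℕ) : ℝ) * F.L * inp.B₀) + 1))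
    (hα3 : α ≤ c2' 4 F.L / 2) (hα5 : α ≤ 1 / 10 ^ 9)
    (hε : o.ε < α) (hΛ₁ : 0 < o.Λ₁) (hΛ₂' : 177 * α * (5 * ((4 : ℕ) : ℝ) * F.L * B₀β + 5 * ((4 : ℕ) : ℝ) * F.L * inp.B₀) ≤ o.Λ₂')
    {b' c' : ℝ} (hb' : 0 ≤ b') (hc' : 0 ≤ c')
    (hRb : 2 ^ 15 * ((4 : ℝ) + 1) ^ 2 * ((4 : ℝ) + 4) ^ 2 * (F.L : ℝ) ^ 2 * b' ≤ 1)
    (hcF : 23040 * (4 : ℝ) ^ 4 * (frameC 4 F.L + 4) ^ 3 * (c' + curConst 4 F.L * b' ^ 2) ≤ 1)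
    (hXα : b' + 226 * (8 * ((4 : ℝ) + 1) * ((4 : ℝ) + 4)) ^ 2 * b' ^ 2 < α) (hY : 4 * ((4 : ℝ) - 1) * (c' + curConst 4 F.L * b' ^ 2) < α) :
    letI : CStarAlgebra (Matrix (Fin N) (Fin N) ℂ) := {}
    B8.Thm4Body c₁ B₁' (fun i : {i : ZdIdx 4 F.L // (∀ j, i.Ω j = Set.univ) ∧ (∀ m j, i.Λs m j = {_y | j = m}) ∧ (∀ m j, i.Λb m j = {_c | j = m}) ∧ i.η = ((F.L : ℝ)⁻¹) ^ i.k} => (zdGF3 (Matrix (Fin N) (Fin N) ℂ) F.L β len i.1).toGFData) →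
      B8.Prop3Body cP 4 (F.L : ℝ) C₂ inp B₀β
        (fun i : {i : ZdIdx 4 F.L // (∀ j, i.Ω j = Set.univ) ∧ (∀ m j, i.Λs m j = {_y | j = m}) ∧ (∀ m j, i.Λb m j = {_c | j = m}) ∧ i.η = ((F.L : ℝ)⁻¹) ^ i.k} => (zdGF3 (Matrix (Fin N) (Fin N) ℂ) F.L β len i.1).toGFData2) →
      LeafH3sup 4 F.L o.Nper o.ε b' c' o.dom →
      LeafSlotHolderAT (ne3OfRecord₁₁ F o) β := by
  letI : CStarAlgebra (Matrix (Fin N) (Fin N) ℂ) := {}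
  intro hT hP h3
  have hL0 : (0 : ℝ) < F.L := by have := HistoryFlow.two_le_L F; positivity
  have hB0 : 0 < 5 * ((4 : ℕ) : ℝ) * F.L * inp.B₀ := by have := inp.B₀_pos; positivity
  have h16' : 16 * (B₁' * c₁') ≤ 1 := by
    obtain ⟨-, -, -, h, -⟩ := hwin (c₁' / 2) (c₁' / 2) (by linarith) (by linarith) (by linarith)
    rwa [add_halves] at h
  obtain ⟨h16, hA3, hA2, hAs, hAc, hMcα, hC335, hss, hgrad, hℓ, hhol⟩ :=
    slotLetterLines F.L (c' + curConst 4 F.L * b' ^ 2) hα hα1 hα2 hα3 hα5 hB0 hBB hc₁' h16' hΛ₁ hΛ₂' hXα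
  exact ⟨len, c₁, c₁', B₁', cP, C₂, B₀β, inp, _, _, b', c', α, 0, 1, fun _ => ∅, hlen, hlen1, hB₁', hBB, rfl, rfl, h16, hwin,
    hb', hc', hRb, hcF, hα, hA3, hA2, hAs, hAc, hXα, hY, le_rfl, hMcα, fun _ _ hq => hq.elim, hC335, hε, hss, hgrad, hℓ, hhol, hT, hP, h3⟩

/-- **THE WINDOW RECIPE AT EXPONENT `β`, LINEAR** (dag-ref-B READ-445): N07's leaf letters `0 ≤ b' ≤ α∕2048`, `0 ≤ c' ≤ α∕24`; the class radius `o.ε < α` free, so N07's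
linear leaf `b' = c' = C·ε` is admissible at `ε ≤ α∕(2048·C)` (file 17's `leafLines_of_linear`). [folklore] -/
theorem leafSlotHolderAT_ofRecord_of_window_linear (F : T4Family) (o : NE3Objects₁₁ N) {β : ℝ}
    {len : Site 4 → ℝ} (hlen : ∀ v : Site 4, 0 < len v → 1 ≤ len v) (hlen1 : ∀ μ : Fin 4, len (e μ) = 1)
    {c₁ c₁' B₁' cP C₂ B₀β : ℝ} {inp : B8.B9Inputs} (hB₁' : 0 < B₁') (hBB : 5 * ((4 : ℕ) : ℝ) * F.L * inp.B₀ ≤ B₁') (hc₁' : 0 < c₁')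
    (hwin : ∀ α₀ α₁ : ℝ, 0 < α₀ → 0 < α₁ → α₀ + α₁ ≤ c₁' →
      α₀ + α₁ ≤ c₁ ∧ C0 4 * (2 * α₀) ≤ 1 / 3 ∧ 4 * α₀ ≤ c2' 4 F.L ∧ 16 * (B₁' * (α₀ + α₁)) ≤ 1 ∧
      Real.exp (4 * (800 * (((4 : ℕ) : ℝ) + 1) ^ 2 * (((4 : ℕ) : ℝ) + 4)) * α₀) * (1 + 8 * (131072 * (((4 : ℕ) : ℝ) + 1) ^ 2) * (B₁' * (α₀ + α₁))) ≤ 2 ∧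
      2 * (B₁' * (α₀ + α₁)) ≤ c3 4 F.L ∧ ((4 : ℕ) : ℝ) * F.L * α₁ ≤ 1 / 8 ∧ α₀ ≤ cP ∧ α₁ ≤ cP ∧ B₁' * (α₀ + α₁) ≤ cP ∧
      2 * (B₁' * (α₀ + α₁)) ^ 2 + 20 * ((4 : ℕ) : ℝ) * α₀ * (B₁' * (α₀ + α₁)) + 2 * C₂ * (B₁' * (α₀ + α₁)) ^ 2 ≤ α₀ + α₁)
    {α : ℝ} (hα : 0 < α) (hα1 : α ≤ c₁' / 177) (hα2 : α ≤ o.Λ₁ / (1770 * (5 * ((4 : ℕ) : ℝ) * F.L * inp.B₀) + 1))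
    (hα3 : α ≤ c2' 4 F.L / 2) (hα4 : α ≤ 1 / ((23040 * (4 : ℝ) ^ 4 * (frameC 4 F.L + 4) ^ 3 + 12) * (1 + curConst 4 F.L) + 1))
    (hα5 : α ≤ 1 / 10 ^ 9)
    (hε : o.ε < α) (hΛ₁ : 0 < o.Λ₁) (hΛ₂' : 177 * α * (5 * ((4 : ℕ) : ℝ) * F.L * B₀β + 5 * ((4 : ℕ) : ℝ) * F.L * inp.B₀) ≤ o.Λ₂')
    {b' c' : ℝ} (hb' : 0 ≤ b') (hb'α : b' ≤ α / 2048) (hc' : 0 ≤ c') (hc'α : c' ≤ α / 24) :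
    letI : CStarAlgebra (Matrix (Fin N) (Fin N) ℂ) := {}
    B8.Thm4Body c₁ B₁' (fun i : {i : ZdIdx 4 F.L // (∀ j, i.Ω j = Set.univ) ∧ (∀ m j, i.Λs m j = {_y | j = m}) ∧ (∀ m j, i.Λb m j = {_c | j = m}) ∧ i.η = ((F.L : ℝ)⁻¹) ^ i.k} => (zdGF3 (Matrix (Fin N) (Fin N) ℂ) F.L β len i.1).toGFData) →
      B8.Prop3Body cP 4 (F.L : ℝ) C₂ inp B₀β
        (fun i : {i : ZdIdx 4 F.L // (∀ j, i.Ω j = Set.univ) ∧ (∀ m j, i.Λs m j = {_y | j = m}) ∧ (∀ m j, i.Λb m j = {_c | j = m}) ∧ i.η = ((F.L : ℝ)⁻¹) ^ i.k} => (zdGF3 (Matrix (Fin N) (Fin N) ℂ) F.L β len i.1).toGFData2) →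
      LeafH3sup 4 F.L o.Nper o.ε b' c' o.dom →
      LeafSlotHolderAT (ne3OfRecord₁₁ F o) β :=
  have h := leafLines_of_linear (le_trans one_le_two (HistoryFlow.two_le_L F)) hα hα3 hα4 hα5 hb' hb'α hc'α
  leafSlotHolderAT_ofRecord_of_window_lines F o hlen hlen1 hB₁' hBB hc₁' hwin hα hα1 hα2 hα3 hα5 hε hΛ₁ hΛ₂' hb' hc' h.1 h.2.1 h.2.2.1 h.2.2.2

/-! ## §2 The window recipes at exponent `β`, multi-scale letters (the R-β″ slot, AT-keyed) -/

/-- **THE WINDOW RECIPE FOR THE MS SLOT, LINE-EXACT** — `LeafSlotHolderMSAT · β` AT RR-1's OBJECT FROM ITS THREE CONTENT CLAUSES ((F2)'s `leafSlotHolderAT_ofRecord_of_window_lines`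
with the MS length letter `len (j • e μ) = j` and the `10·` Hölder threshold): N07's leaf letters enter only through the slot's four displayed `(b', c')`-lines; `o.ε < α` free;
the numeric lines are file 17's `slotLetterLines` plus `slotHolderLineMS`.  LOCALISATION LETTERS DEGENERATE (`Mc := 0`, `C₃₃₅ := 1`, `𝒬 := fun _ ↦ ∅` — vacuity over `∅`; a
consumer needing a non-trivial `𝒬` gets nothing from this witness). [folklore] -/
theorem leafSlotHolderMSAT_ofRecord_of_window_lines (F : T4Family) (o : NE3Objects₁₁ N) {β : ℝ}
    {len : Site 4 → ℝ} (hlen : ∀ v : Site 4, 0 < len v → 1 ≤ len v) (hlenj : ∀ (μ : Fin 4) (j : ℕ), len (j • e μ) = j)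
    {c₁ c₁' B₁' cP C₂ B₀β : ℝ} {inp : B8.B9Inputs} (hB₁' : 0 < B₁') (hBB : 5 * ((4 : ℕ) : ℝ) * F.L * inp.B₀ ≤ B₁') (hc₁' : 0 < c₁')
    (hwin : ∀ α₀ α₁ : ℝ, 0 < α₀ → 0 < α₁ → α₀ + α₁ ≤ c₁' →
      α₀ + α₁ ≤ c₁ ∧ C0 4 * (2 * α₀) ≤ 1 / 3 ∧ 4 * α₀ ≤ c2' 4 F.L ∧ 16 * (B₁' * (α₀ + α₁)) ≤ 1 ∧
      Real.exp (4 * (800 * (((4 : ℕ) : ℝ) + 1) ^ 2 * (((4 : ℕ) : ℝ) + 4)) * α₀) * (1 + 8 * (131072 * (((4 : ℕ) : ℝ) + 1) ^ 2) * (B₁' * (α₀ + α₁))) ≤ 2 ∧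
      2 * (B₁' * (α₀ + α₁)) ≤ c3 4 F.L ∧ ((4 : ℕ) : ℝ) * F.L * α₁ ≤ 1 / 8 ∧ α₀ ≤ cP ∧ α₁ ≤ cP ∧ B₁' * (α₀ + α₁) ≤ cP ∧
      2 * (B₁' * (α₀ + α₁)) ^ 2 + 20 * ((4 : ℕ) : ℝ) * α₀ * (B₁' * (α₀ + α₁)) + 2 * C₂ * (B₁' * (α₀ + α₁)) ^ 2 ≤ α₀ + α₁)
    {α : ℝ} (hα : 0 < α) (hα1 : α ≤ c₁' / 177) (hα2 : α ≤ o.Λ₁ / (1770 * (5 * ((4 : ℕ) : ℝ) * F.L * inp.B₀) + 1))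
    (hα3 : α ≤ c2' 4 F.L / 2) (hα5 : α ≤ 1 / 10 ^ 9)
    (hε : o.ε < α) (hΛ₁ : 0 < o.Λ₁) (hΛ₂' : 177 * α * (5 * ((4 : ℕ) : ℝ) * F.L * B₀β + 5 * ((4 : ℕ) : ℝ) * F.L * inp.B₀) ≤ o.Λ₂')
    {b' c' : ℝ} (hb' : 0 ≤ b') (hc' : 0 ≤ c')
    (hRb : 2 ^ 15 * ((4 : ℝ) + 1) ^ 2 * ((4 : ℝ) + 4) ^ 2 * (F.L : ℝ) ^ 2 * b' ≤ 1)
    (hcF : 23040 * (4 : ℝ) ^ 4 * (frameC 4 F.L + 4) ^ 3 * (c' + curConst 4 F.L * b' ^ 2) ≤ 1)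
    (hXα : b' + 226 * (8 * ((4 : ℝ) + 1) * ((4 : ℝ) + 4)) ^ 2 * b' ^ 2 < α) (hY : 4 * ((4 : ℝ) - 1) * (c' + curConst 4 F.L * b' ^ 2) < α) :
    letI : CStarAlgebra (Matrix (Fin N) (Fin N) ℂ) := {}
    B8.Thm4Body c₁ B₁' (fun i : {i : ZdIdx 4 F.L // (∀ j, i.Ω j = Set.univ) ∧ (∀ m j, i.Λs m j = {_y | j = m}) ∧ (∀ m j, i.Λb m j = {_c | j = m}) ∧ i.η = ((F.L : ℝ)⁻¹) ^ i.k} => (zdGF3 (Matrix (Fin N) (Fin N) ℂ) F.L β len i.1).toGFData) →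
      B8.Prop3Body cP 4 (F.L : ℝ) C₂ inp B₀β
        (fun i : {i : ZdIdx 4 F.L // (∀ j, i.Ω j = Set.univ) ∧ (∀ m j, i.Λs m j = {_y | j = m}) ∧ (∀ m j, i.Λb m j = {_c | j = m}) ∧ i.η = ((F.L : ℝ)⁻¹) ^ i.k} => (zdGF3 (Matrix (Fin N) (Fin N) ℂ) F.L β len i.1).toGFData2) →
      LeafH3sup 4 F.L o.Nper o.ε b' c' o.dom →
      LeafSlotHolderMSAT (ne3OfRecord₁₁ F o) β := by
  letI : CStarAlgebra (Matrix (Fin N) (Fin N) ℂ) := {}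
  intro hT hP h3
  have hL0 : (0 : ℝ) < F.L := by have := HistoryFlow.two_le_L F; positivity
  have hB0 : 0 < 5 * ((4 : ℕ) : ℝ) * F.L * inp.B₀ := by have := inp.B₀_pos; positivity
  have h16' : 16 * (B₁' * c₁') ≤ 1 := by
    obtain ⟨-, -, -, h, -⟩ := hwin (c₁' / 2) (c₁' / 2) (by linarith) (by linarith) (by linarith)
    rwa [add_halves] at h
  obtain ⟨h16, hA3, hA2, hAs, hAc, hMcα, hC335, hss, hgrad, hℓ, -⟩ :=
    slotLetterLines F.L (c' + curConst 4 F.L * b' ^ 2) hα hα1 hα2 hα3 hα5 hB0 hBB hc₁' h16' hΛ₁ hΛ₂' hXα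
  have hhol := slotHolderLineMS hα hα2 hα5 hB0 hΛ₂' hXα
  exact ⟨len, c₁, c₁', B₁', cP, C₂, B₀β, inp, _, _, b', c', α, 0, 1, fun _ => ∅, hlen, hlenj, hB₁', hBB, rfl, rfl, h16, hwin,
    hb', hc', hRb, hcF, hα, hA3, hA2, hAs, hAc, hXα, hY, le_rfl, hMcα, fun _ _ hq => hq.elim, hC335, hε, hss, hgrad, hℓ, hhol, hT, hP, h3⟩

/-- **THE WINDOW RECIPE FOR THE MS SLOT, LINEAR** (dag-ref-B READ-445's recipe): N07's leaf letters `0 ≤ b' ≤ α∕2048`, `0 ≤ c' ≤ α∕24`; the class radius `o.ε < α` free, so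
N07's linear leaf `b' = c' = C·ε` is admissible at `ε ≤ α∕(2048·C)` (file 17's `leafLines_of_linear`).  Localisation letters degenerate as above. [folklore] -/
theorem leafSlotHolderMSAT_ofRecord_of_window_linear (F : T4Family) (o : NE3Objects₁₁ N) {β : ℝ}
    {len : Site 4 → ℝ} (hlen : ∀ v : Site 4, 0 < len v → 1 ≤ len v) (hlenj : ∀ (μ : Fin 4) (j : ℕ), len (j • e μ) = j)
    {c₁ c₁' B₁' cP C₂ B₀β : ℝ} {inp : B8.B9Inputs} (hB₁' : 0 < B₁') (hBB : 5 * ((4 : ℕ) : ℝ) * F.L * inp.B₀ ≤ B₁') (hc₁' : 0 < c₁')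
    (hwin : ∀ α₀ α₁ : ℝ, 0 < α₀ → 0 < α₁ → α₀ + α₁ ≤ c₁' →
      α₀ + α₁ ≤ c₁ ∧ C0 4 * (2 * α₀) ≤ 1 / 3 ∧ 4 * α₀ ≤ c2' 4 F.L ∧ 16 * (B₁' * (α₀ + α₁)) ≤ 1 ∧
      Real.exp (4 * (800 * (((4 : ℕ) : ℝ) + 1) ^ 2 * (((4 : ℕ) : ℝ) + 4)) * α₀) * (1 + 8 * (131072 * (((4 : ℕ) : ℝ) + 1) ^ 2) * (B₁' * (α₀ + α₁))) ≤ 2 ∧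
      2 * (B₁' * (α₀ + α₁)) ≤ c3 4 F.L ∧ ((4 : ℕ) : ℝ) * F.L * α₁ ≤ 1 / 8 ∧ α₀ ≤ cP ∧ α₁ ≤ cP ∧ B₁' * (α₀ + α₁) ≤ cP ∧
      2 * (B₁' * (α₀ + α₁)) ^ 2 + 20 * ((4 : ℕ) : ℝ) * α₀ * (B₁' * (α₀ + α₁)) + 2 * C₂ * (B₁' * (α₀ + α₁)) ^ 2 ≤ α₀ + α₁)
    {α : ℝ} (hα : 0 < α) (hα1 : α ≤ c₁' / 177) (hα2 : α ≤ o.Λ₁ / (1770 * (5 * ((4 : ℕ) : ℝ) * F.L * inp.B₀) + 1))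
    (hα3 : α ≤ c2' 4 F.L / 2) (hα4 : α ≤ 1 / ((23040 * (4 : ℝ) ^ 4 * (frameC 4 F.L + 4) ^ 3 + 12) * (1 + curConst 4 F.L) + 1))
    (hα5 : α ≤ 1 / 10 ^ 9)
    (hε : o.ε < α) (hΛ₁ : 0 < o.Λ₁) (hΛ₂' : 177 * α * (5 * ((4 : ℕ) : ℝ) * F.L * B₀β + 5 * ((4 : ℕ) : ℝ) * F.L * inp.B₀) ≤ o.Λ₂')
    {b' c' : ℝ} (hb' : 0 ≤ b') (hb'α : b' ≤ α / 2048) (hc' : 0 ≤ c') (hc'α : c' ≤ α / 24) :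
    letI : CStarAlgebra (Matrix (Fin N) (Fin N) ℂ) := {}
    B8.Thm4Body c₁ B₁' (fun i : {i : ZdIdx 4 F.L // (∀ j, i.Ω j = Set.univ) ∧ (∀ m j, i.Λs m j = {_y | j = m}) ∧ (∀ m j, i.Λb m j = {_c | j = m}) ∧ i.η = ((F.L : ℝ)⁻¹) ^ i.k} => (zdGF3 (Matrix (Fin N) (Fin N) ℂ) F.L β len i.1).toGFData) →
      B8.Prop3Body cP 4 (F.L : ℝ) C₂ inp B₀β
        (fun i : {i : ZdIdx 4 F.L // (∀ j, i.Ω j = Set.univ) ∧ (∀ m j, i.Λs m j = {_y | j = m}) ∧ (∀ m j, i.Λb m j = {_c | j = m}) ∧ i.η = ((F.L : ℝ)⁻¹) ^ i.k} => (zdGF3 (Matrix (Fin N) (Fin N) ℂ) F.L β len i.1).toGFData2) →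
      LeafH3sup 4 F.L o.Nper o.ε b' c' o.dom →
      LeafSlotHolderMSAT (ne3OfRecord₁₁ F o) β :=
  have h := leafLines_of_linear (le_trans one_le_two (HistoryFlow.two_le_L F)) hα hα3 hα4 hα5 hb' hb'α hc'α
  leafSlotHolderMSAT_ofRecord_of_window_lines F o hlen hlenj hB₁' hBB hc₁' hwin hα hα1 hα2 hα3 hα5 hε hΛ₁ hΛ₂' hb' hc' h.1 h.2.1 h.2.2.1 h.2.2.2

/-! ## §3 Per family: the proviso of the currency AND the AT-keyed slot at RR-1's object of record with windowed letters, linear currency -/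

section FamilyOne

variable [NeZero N] (ℓ : T4Family → NE3Letters₁₁)
  -- N05's constants, per family; the averaging letter in N05's window and N07's leaf letters, per family
  {len : T4Family → Site 4 → ℝ} {c₁ c₁' B₁' cP C₂ B₀β : T4Family → ℝ} {inp : T4Family → B8.B9Inputs} {α b' c' : T4Family → ℝ}
  (hlen : ∀ (F : T4Family) (v : Site 4), 0 < len F v → 1 ≤ len F v) (hlen1 : ∀ (F : T4Family) (μ : Fin 4), len F (e μ) = 1)
  (hB₁' : ∀ F, 0 < B₁' F) (hBB : ∀ F : T4Family, 5 * ((4 : ℕ) : ℝ) * F.L * (inp F).B₀ ≤ B₁' F) (hc₁' : ∀ F, 0 < c₁' F)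
  (hwin : ∀ (F : T4Family) (α₀ α₁ : ℝ), 0 < α₀ → 0 < α₁ → α₀ + α₁ ≤ c₁' F →
    α₀ + α₁ ≤ c₁ F ∧ C0 4 * (2 * α₀) ≤ 1 / 3 ∧ 4 * α₀ ≤ c2' 4 F.L ∧ 16 * (B₁' F * (α₀ + α₁)) ≤ 1 ∧
    Real.exp (4 * (800 * (((4 : ℕ) : ℝ) + 1) ^ 2 * (((4 : ℕ) : ℝ) + 4)) * α₀) * (1 + 8 * (131072 * (((4 : ℕ) : ℝ) + 1) ^ 2) * (B₁' F * (α₀ + α₁))) ≤ 2 ∧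
    2 * (B₁' F * (α₀ + α₁)) ≤ c3 4 F.L ∧ ((4 : ℕ) : ℝ) * F.L * α₁ ≤ 1 / 8 ∧ α₀ ≤ cP F ∧ α₁ ≤ cP F ∧ B₁' F * (α₀ + α₁) ≤ cP F ∧
    2 * (B₁' F * (α₀ + α₁)) ^ 2 + 20 * ((4 : ℕ) : ℝ) * α₀ * (B₁' F * (α₀ + α₁)) + 2 * C₂ F * (B₁' F * (α₀ + α₁)) ^ 2 ≤ α₀ + α₁)
  (hα : ∀ F, 0 < α F) (hα1 : ∀ F, α F ≤ c₁' F / 177)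
  (hα2 : ∀ F : T4Family, α F ≤ (ℓ F).Λ₁ / (1770 * (5 * ((4 : ℕ) : ℝ) * F.L * (inp F).B₀) + 1))
  (hα3 : ∀ F : T4Family, α F ≤ c2' 4 F.L / 2)
  (hα4 : ∀ F : T4Family, α F ≤ 1 / ((23040 * (4 : ℝ) ^ 4 * (frameC 4 F.L + 4) ^ 3 + 12) * (1 + curConst 4 F.L) + 1))
  (hα5 : ∀ F, α F ≤ 1 / 10 ^ 9)
  (hg : ∀ F, 0 < (ℓ F).g) (hε0 : ∀ F, 0 < (ℓ F).ε) (hε : ∀ F, (ℓ F).ε < α F)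
  (hΛ₁r : ∀ F : T4Family, (ℓ F).Λ₁ ≤ radiusOfRecord N F.L (ne3NperOfRecord₁₁ F 0 0))
  (hb : ∀ F, 0 ≤ (ℓ F).b ∧ (ℓ F).b ≤ (ℓ F).ε / 2) (hC : ∀ F : T4Family, constOfRecord N F.L (ne3NperOfRecord₁₁ F 0 0) (ℓ F).g ≤ (ℓ F).C)
  (hΛ₂' : ∀ F : T4Family, 177 * α F * (5 * ((4 : ℕ) : ℝ) * F.L * B₀β F + 5 * ((4 : ℕ) : ℝ) * F.L * (inp F).B₀) ≤ (ℓ F).Λ₂')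
  (hb' : ∀ F, 0 ≤ b' F ∧ b' F ≤ α F / 2048) (hc' : ∀ F, 0 ≤ c' F ∧ c' F ≤ α F / 24)
include hlen hlen1 hB₁' hBB hc₁' hwin hα hα1 hα2 hα3 hα4 hα5 hg hε0 hε hΛ₁r hb hC hΛ₂' hb' hc'

/-- Per family: the proviso and — from the content — the slot, at windowed letters `ℓ F` in the linear currency. [folklore] -/
theorem inEndRegime_and_leafSlotAT_ofRecord_of_window_linear (F : T4Family)
    (hT : letI : CStarAlgebra (Matrix (Fin N) (Fin N) ℂ) := {}
      B8.Thm4Body (c₁ F) (B₁' F) (fun i : {i : ZdIdx 4 F.L // (∀ j, i.Ω j = Set.univ) ∧ (∀ m j, i.Λs m j = {_y | j = m}) ∧ (∀ m j, i.Λb m j = {_c | j = m}) ∧ i.η = ((F.L : ℝ)⁻¹) ^ i.k} => (zdGF3 (Matrix (Fin N) (Fin N) ℂ) F.L 1 (len F) i.1).toGFData))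
    (hP : letI : CStarAlgebra (Matrix (Fin N) (Fin N) ℂ) := {}
      B8.Prop3Body (cP F) 4 (F.L : ℝ) (C₂ F) (inp F) (B₀β F)
        (fun i : {i : ZdIdx 4 F.L // (∀ j, i.Ω j = Set.univ) ∧ (∀ m j, i.Λs m j = {_y | j = m}) ∧ (∀ m j, i.Λb m j = {_c | j = m}) ∧ i.η = ((F.L : ℝ)⁻¹) ^ i.k} => (zdGF3 (Matrix (Fin N) (Fin N) ℂ) F.L 1 (len F) i.1).toGFData2))
    (h3 : LeafH3sup 4 F.L (ne3NperOfRecord₁₁ F 0 0) (ℓ F).ε (b' F) (c' F) (ne3DomOfRecord₁₁ F N 0 0)) :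
    InEndRegime (ne3OfRecord₁₁ F (ne3ConstLayerOfRecord₁₁ F N (ℓ F))) ∧ LeafSlotAT (ne3OfRecord₁₁ F (ne3ConstLayerOfRecord₁₁ F N (ℓ F))) := by
  letI : CStarAlgebra (Matrix (Fin N) (Fin N) ℂ) := {}
  have hB0 : 0 < 5 * ((4 : ℕ) : ℝ) * F.L * (inp F).B₀ := by
    have := (inp F).B₀_pos; have := HistoryFlow.two_le_L F; positivity
  refine ⟨inEndRegime_ofRecord_of_window F (ne3ConstLayerOfRecord₁₁ F N (ℓ F)) (one_le_ne3NperOfRecord₁₁ F 0 0) (hg F) hB0.le (hα2 F) (hε0 F) (hε F)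
    (hΛ₁r F) (hb F).1 (hb F).2 (hC F), ?_⟩
  -- `0 < Λ₁`: `0 < α ≤ Λ₁∕(1770·B+1) ≤ Λ₁`
  have hΛpos : 0 < (ℓ F).Λ₁ := by
    have hBp : 0 < 1770 * (5 * ((4 : ℕ) : ℝ) * F.L * (inp F).B₀) + 1 := by positivity
    have h := (le_div_iff₀ hBp).1 (hα2 F)
    have hαp : 0 < α F := hα F
    nlinarith only [h, hB0, hαp]
  exact leafSlotHolderAT_ofRecord_of_window_linear F (ne3ConstLayerOfRecord₁₁ F N (ℓ F)) (hlen F) (hlen1 F) (hB₁' F) (hBB F) (hc₁' F) (hwin F) (hα F) (hα1 F) (hα2 F)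
    (hα3 F) (hα4 F) (hα5 F) (hε F) hΛpos (hΛ₂' F) (hb' F).1 (hb' F).2 (hc' F).1 (hc' F).2 hT hP h3

end FamilyOne

section FamilyHolder

variable [NeZero N] {β : ℝ} (ℓ : T4Family → NE3Letters₁₁)
  -- N05's constants, per family; the averaging letter in N05's window and N07's leaf letters, per family
  {len : T4Family → Site 4 → ℝ} {c₁ c₁' B₁' cP C₂ B₀β : T4Family → ℝ} {inp : T4Family → B8.B9Inputs} {α b' c' : T4Family → ℝ}
  (hlen : ∀ (F : T4Family) (v : Site 4), 0 < len F v → 1 ≤ len F v) (hlen1 : ∀ (F : T4Family) (μ : Fin 4), len F (e μ) = 1)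
  (hB₁' : ∀ F, 0 < B₁' F) (hBB : ∀ F : T4Family, 5 * ((4 : ℕ) : ℝ) * F.L * (inp F).B₀ ≤ B₁' F) (hc₁' : ∀ F, 0 < c₁' F)
  (hwin : ∀ (F : T4Family) (α₀ α₁ : ℝ), 0 < α₀ → 0 < α₁ → α₀ + α₁ ≤ c₁' F →
    α₀ + α₁ ≤ c₁ F ∧ C0 4 * (2 * α₀) ≤ 1 / 3 ∧ 4 * α₀ ≤ c2' 4 F.L ∧ 16 * (B₁' F * (α₀ + α₁)) ≤ 1 ∧
    Real.exp (4 * (800 * (((4 : ℕ) : ℝ) + 1) ^ 2 * (((4 : ℕ) : ℝ) + 4)) * α₀) * (1 + 8 * (131072 * (((4 : ℕ) : ℝ) + 1) ^ 2) * (B₁' F * (α₀ + α₁))) ≤ 2 ∧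
    2 * (B₁' F * (α₀ + α₁)) ≤ c3 4 F.L ∧ ((4 : ℕ) : ℝ) * F.L * α₁ ≤ 1 / 8 ∧ α₀ ≤ cP F ∧ α₁ ≤ cP F ∧ B₁' F * (α₀ + α₁) ≤ cP F ∧
    2 * (B₁' F * (α₀ + α₁)) ^ 2 + 20 * ((4 : ℕ) : ℝ) * α₀ * (B₁' F * (α₀ + α₁)) + 2 * C₂ F * (B₁' F * (α₀ + α₁)) ^ 2 ≤ α₀ + α₁)
  (hα : ∀ F, 0 < α F) (hα1 : ∀ F, α F ≤ c₁' F / 177)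
  (hα2 : ∀ F : T4Family, α F ≤ (ℓ F).Λ₁ / (1770 * (5 * ((4 : ℕ) : ℝ) * F.L * (inp F).B₀) + 1))
  (hα3 : ∀ F : T4Family, α F ≤ c2' 4 F.L / 2)
  (hα4 : ∀ F : T4Family, α F ≤ 1 / ((23040 * (4 : ℝ) ^ 4 * (frameC 4 F.L + 4) ^ 3 + 12) * (1 + curConst 4 F.L) + 1))
  (hα5 : ∀ F, α F ≤ 1 / 10 ^ 9)
  (hg : ∀ F, 0 < (ℓ F).g) (hε0 : ∀ F, 0 < (ℓ F).ε) (hε : ∀ F, (ℓ F).ε < α F)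
  (hΛ₁r : ∀ F : T4Family, (ℓ F).Λ₁ ≤ radiusOfRecordH N F.L (ne3NperOfRecord₁₁ F 0 0))
  (hb : ∀ F, 0 ≤ (ℓ F).b ∧ (ℓ F).b ≤ (ℓ F).ε / 2) (hC : ∀ F : T4Family, constOfRecordH N F.L (ne3NperOfRecord₁₁ F 0 0) (ℓ F).g ≤ (ℓ F).C)
  (hΛ₂' : ∀ F : T4Family, 177 * α F * (5 * ((4 : ℕ) : ℝ) * F.L * B₀β F + 5 * ((4 : ℕ) : ℝ) * F.L * (inp F).B₀) ≤ (ℓ F).Λ₂')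
  (hb' : ∀ F, 0 ≤ b' F ∧ b' F ≤ α F / 2048) (hc' : ∀ F, 0 ≤ c' F ∧ c' F ≤ α F / 24)
include hlen hlen1 hB₁' hBB hc₁' hwin hα hα1 hα2 hα3 hα4 hα5 hg hε0 hε hΛ₁r hb hC hΛ₂' hb' hc'

/-- Per family: the H-proviso and — from the content — the Holder slot, at the windowed letters `ℓ F` (§2 twice, linear currency). [folklore] -/
theorem inEndRegimeH_and_leafSlotHolderAT_ofRecord_of_window_linear (F : T4Family)
    (hT : letI : CStarAlgebra (Matrix (Fin N) (Fin N) ℂ) := {}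
      B8.Thm4Body (c₁ F) (B₁' F) (fun i : {i : ZdIdx 4 F.L // (∀ j, i.Ω j = Set.univ) ∧ (∀ m j, i.Λs m j = {_y | j = m}) ∧ (∀ m j, i.Λb m j = {_c | j = m}) ∧ i.η = ((F.L : ℝ)⁻¹) ^ i.k} => (zdGF3 (Matrix (Fin N) (Fin N) ℂ) F.L β (len F) i.1).toGFData))
    (hP : letI : CStarAlgebra (Matrix (Fin N) (Fin N) ℂ) := {}
      B8.Prop3Body (cP F) 4 (F.L : ℝ) (C₂ F) (inp F) (B₀β F)
        (fun i : {i : ZdIdx 4 F.L // (∀ j, i.Ω j = Set.univ) ∧ (∀ m j, i.Λs m j = {_y | j = m}) ∧ (∀ m j, i.Λb m j = {_c | j = m}) ∧ i.η = ((F.L : ℝ)⁻¹) ^ i.k} => (zdGF3 (Matrix (Fin N) (Fin N) ℂ) F.L β (len F) i.1).toGFData2))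
    (h3 : LeafH3sup 4 F.L (ne3NperOfRecord₁₁ F 0 0) (ℓ F).ε (b' F) (c' F) (ne3DomOfRecord₁₁ F N 0 0)) :
    InEndRegimeH (ne3OfRecord₁₁ F (ne3ConstLayerOfRecord₁₁ F N (ℓ F))) ∧ LeafSlotHolderAT (ne3OfRecord₁₁ F (ne3ConstLayerOfRecord₁₁ F N (ℓ F))) β := by
  letI : CStarAlgebra (Matrix (Fin N) (Fin N) ℂ) := {}
  have hB0 : 0 < 5 * ((4 : ℕ) : ℝ) * F.L * (inp F).B₀ := by
    have := (inp F).B₀_pos; have := HistoryFlow.two_le_L F; positivity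
  refine ⟨inEndRegimeH_ofRecord_of_window F (ne3ConstLayerOfRecord₁₁ F N (ℓ F)) (one_le_ne3NperOfRecord₁₁ F 0 0) (hg F) hB0.le (hα2 F) (hε0 F) (hε F)
    (hΛ₁r F) (hb F).1 (hb F).2 (hC F), ?_⟩
  -- `0 < Λ₁`: `0 < α ≤ Λ₁∕(1770·B+1) ≤ Λ₁`
  have hΛpos : 0 < (ℓ F).Λ₁ := by
    have hBp : 0 < 1770 * (5 * ((4 : ℕ) : ℝ) * F.L * (inp F).B₀) + 1 := by positivity
    have h := (le_div_iff₀ hBp).1 (hα2 F)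
    have hαp : 0 < α F := hα F
    nlinarith only [h, hB0, hαp]
  exact leafSlotHolderAT_ofRecord_of_window_linear F (ne3ConstLayerOfRecord₁₁ F N (ℓ F)) (hlen F) (hlen1 F) (hB₁' F) (hBB F) (hc₁' F) (hwin F) (hα F) (hα1 F) (hα2 F)
    (hα3 F) (hα4 F) (hα5 F) (hε F) hΛpos (hΛ₂' F) (hb' F).1 (hb' F).2 (hc' F).1 (hc' F).2 hT hP h3

end FamilyHolder

section FamilyHolderMS

variable [NeZero N] {β : ℝ} (ℓ : T4Family → NE3Letters₁₁)
  -- N05's constants, per family (MS length letter); the averaging letter in N05's window and N07's leaf letters, per family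
  {len : T4Family → Site 4 → ℝ} {c₁ c₁' B₁' cP C₂ B₀β : T4Family → ℝ} {inp : T4Family → B8.B9Inputs} {α b' c' : T4Family → ℝ}
  (hlen : ∀ (F : T4Family) (v : Site 4), 0 < len F v → 1 ≤ len F v) (hlenj : ∀ (F : T4Family) (μ : Fin 4) (j : ℕ), len F (j • e μ) = j)
  (hB₁' : ∀ F, 0 < B₁' F) (hBB : ∀ F : T4Family, 5 * ((4 : ℕ) : ℝ) * F.L * (inp F).B₀ ≤ B₁' F) (hc₁' : ∀ F, 0 < c₁' F)
  (hwin : ∀ (F : T4Family) (α₀ α₁ : ℝ), 0 < α₀ → 0 < α₁ → α₀ + α₁ ≤ c₁' F →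
    α₀ + α₁ ≤ c₁ F ∧ C0 4 * (2 * α₀) ≤ 1 / 3 ∧ 4 * α₀ ≤ c2' 4 F.L ∧ 16 * (B₁' F * (α₀ + α₁)) ≤ 1 ∧
    Real.exp (4 * (800 * (((4 : ℕ) : ℝ) + 1) ^ 2 * (((4 : ℕ) : ℝ) + 4)) * α₀) * (1 + 8 * (131072 * (((4 : ℕ) : ℝ) + 1) ^ 2) * (B₁' F * (α₀ + α₁))) ≤ 2 ∧
    2 * (B₁' F * (α₀ + α₁)) ≤ c3 4 F.L ∧ ((4 : ℕ) : ℝ) * F.L * α₁ ≤ 1 / 8 ∧ α₀ ≤ cP F ∧ α₁ ≤ cP F ∧ B₁' F * (α₀ + α₁) ≤ cP F ∧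
    2 * (B₁' F * (α₀ + α₁)) ^ 2 + 20 * ((4 : ℕ) : ℝ) * α₀ * (B₁' F * (α₀ + α₁)) + 2 * C₂ F * (B₁' F * (α₀ + α₁)) ^ 2 ≤ α₀ + α₁)
  (hα : ∀ F, 0 < α F) (hα1 : ∀ F, α F ≤ c₁' F / 177)
  (hα2 : ∀ F : T4Family, α F ≤ (ℓ F).Λ₁ / (1770 * (5 * ((4 : ℕ) : ℝ) * F.L * (inp F).B₀) + 1))
  (hα3 : ∀ F : T4Family, α F ≤ c2' 4 F.L / 2)
  (hα4 : ∀ F : T4Family, α F ≤ 1 / ((23040 * (4 : ℝ) ^ 4 * (frameC 4 F.L + 4) ^ 3 + 12) * (1 + curConst 4 F.L) + 1))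
  (hα5 : ∀ F, α F ≤ 1 / 10 ^ 9)
  (hg : ∀ F, 0 < (ℓ F).g) (hε0 : ∀ F, 0 < (ℓ F).ε) (hε : ∀ F, (ℓ F).ε < α F)
  (hΛ₁r : ∀ F : T4Family, (ℓ F).Λ₁ ≤ radiusOfRecordHMS N F.L (ne3NperOfRecord₁₁ F 0 0))
  (hb : ∀ F, 0 ≤ (ℓ F).b ∧ (ℓ F).b ≤ (ℓ F).ε / 2) (hC : ∀ F : T4Family, constOfRecordHMS N F.L (ne3NperOfRecord₁₁ F 0 0) (ℓ F).g ≤ (ℓ F).C)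
  (hΛ₂' : ∀ F : T4Family, 177 * α F * (5 * ((4 : ℕ) : ℝ) * F.L * B₀β F + 5 * ((4 : ℕ) : ℝ) * F.L * (inp F).B₀) ≤ (ℓ F).Λ₂')
  (hb' : ∀ F, 0 ≤ b' F ∧ b' F ≤ α F / 2048) (hc' : ∀ F, 0 ≤ c' F ∧ c' F ≤ α F / 24)
include hlen hlenj hB₁' hBB hc₁' hwin hα hα1 hα2 hα3 hα4 hα5 hg hε0 hε hΛ₁r hb hC hΛ₂' hb' hc'

/-- Per family, STAGE-FREE: the MS proviso and — from the content — the MS slot, at the windowed letters `ℓ F` (§2 twice, linear currency). [folklore] -/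
theorem inEndRegimeHMS_and_leafSlotHolderMSAT_ofRecord_of_window_linear (F : T4Family)
    (hT : letI : CStarAlgebra (Matrix (Fin N) (Fin N) ℂ) := {}
      B8.Thm4Body (c₁ F) (B₁' F) (fun i : {i : ZdIdx 4 F.L // (∀ j, i.Ω j = Set.univ) ∧ (∀ m j, i.Λs m j = {_y | j = m}) ∧ (∀ m j, i.Λb m j = {_c | j = m}) ∧ i.η = ((F.L : ℝ)⁻¹) ^ i.k} => (zdGF3 (Matrix (Fin N) (Fin N) ℂ) F.L β (len F) i.1).toGFData))
    (hP : letI : CStarAlgebra (Matrix (Fin N) (Fin N) ℂ) := {}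
      B8.Prop3Body (cP F) 4 (F.L : ℝ) (C₂ F) (inp F) (B₀β F)
        (fun i : {i : ZdIdx 4 F.L // (∀ j, i.Ω j = Set.univ) ∧ (∀ m j, i.Λs m j = {_y | j = m}) ∧ (∀ m j, i.Λb m j = {_c | j = m}) ∧ i.η = ((F.L : ℝ)⁻¹) ^ i.k} => (zdGF3 (Matrix (Fin N) (Fin N) ℂ) F.L β (len F) i.1).toGFData2))
    (h3 : LeafH3sup 4 F.L (ne3NperOfRecord₁₁ F 0 0) (ℓ F).ε (b' F) (c' F) (ne3DomOfRecord₁₁ F N 0 0)) :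
    InEndRegimeHMS (ne3OfRecord₁₁ F (ne3ConstLayerOfRecord₁₁ F N (ℓ F))) ∧ LeafSlotHolderMSAT (ne3OfRecord₁₁ F (ne3ConstLayerOfRecord₁₁ F N (ℓ F))) β := by
  letI : CStarAlgebra (Matrix (Fin N) (Fin N) ℂ) := {}
  have hB0 : 0 < 5 * ((4 : ℕ) : ℝ) * F.L * (inp F).B₀ := by
    have := (inp F).B₀_pos; have := HistoryFlow.two_le_L F; positivity
  refine ⟨inEndRegimeHMS_ofRecord_of_window F (ne3ConstLayerOfRecord₁₁ F N (ℓ F)) (one_le_ne3NperOfRecord₁₁ F 0 0) (hg F) hB0.le (hα2 F) (hε0 F) (hε F)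
    (hΛ₁r F) (hb F).1 (hb F).2 (hC F), ?_⟩
  -- `0 < Λ₁`: `0 < α ≤ Λ₁∕(1770·B+1) ≤ Λ₁`
  have hΛpos : 0 < (ℓ F).Λ₁ := by
    have hBp : 0 < 1770 * (5 * ((4 : ℕ) : ℝ) * F.L * (inp F).B₀) + 1 := by positivity
    have h := (le_div_iff₀ hBp).1 (hα2 F)
    have hαp : 0 < α F := hα F
    nlinarith only [h, hB0, hαp]
  exact leafSlotHolderMSAT_ofRecord_of_window_linear F (ne3ConstLayerOfRecord₁₁ F N (ℓ F)) (hlen F) (hlenj F) (hB₁' F) (hBB F) (hc₁' F) (hwin F) (hα F) (hα1 F)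
    (hα2 F) (hα3 F) (hα4 F) (hα5 F) (hε F) hΛpos (hΛ₂' F) (hb' F).1 (hb' F).2 (hc' F).1 (hc' F).2 hT hP h3

end FamilyHolderMS

end

end Summit.QuantumFields.YangMills.BalabanUVNodes.N16SlotWindowAllTorus
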